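import Literature.NumberTheory.Automorphic.UnipotentColumnRange
import Literature.MeasureTheory.Group.HaarCharLattice
import HarnessLib

/-!
# Conjugation by rational normalisers preserves the Haar measure of `U_{[a,b]}(𝔸_K)`

Topic `NumberTheory/Automorphic`; namespace `Literature.NumberTheory.Automorphic`. The junction of
`UnipotentColumnRange` (the column-range unipotent groups `U_{[a,b]}(𝔸_K)`, their lattices
`U_{[a,b]}(K)` and Tate boxes) with `Literature.MeasureTheory.Group.HaarCharLattice` (a topological
automorphism preserving a finite-covolume lattice has `mulEquivHaarChar = 1`): **if `g ∈ GL_n(𝔸_K)`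
normalises `U_{[a,b]}(𝔸_K)` and conjugation by `g` maps `U_{[a,b]}(K)` onto itself — e.g. `g` the
diagonal image of a rational matrix (`colRangeConj_mem_rationalColRange_iff`) — then `u ↦ g u g⁻¹`
preserves every Haar measure of `U_{[a,b]}(𝔸_K)`** (`map_colRangeConj_eq_self`), with the
change-of-variables forms `lintegral_colRangeConj_eq`, `integral_colRangeConj_eq`,
`lintegral_colRangeConj_eq_of_rational`, `integral_colRangeConj_eq_of_rational`. This is the
non-abelian analogue of the product formula `|ξ|_𝔸 = 1` that moves rational matrices through the
unipotent integrals of the Rankin–Selberg unfolding (Jacquet–Shalika (1981), §4; Cogdell (2004), §2.3: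
"`γ⁻¹ y γ` … the measure is preserved"). Everything is proved.

## References

* H. Jacquet, J. A. Shalika, *On Euler products and the classification of automorphic
  representations I*, Amer. J. Math. 103 (1981), §4 [JacquetShalikaAJM1981].
* A. Weil, *Basic Number Theory*, Ch. IV §2 (the module of an automorphism; product formula).
-/

noncomputable section

open MeasureTheory Measure NumberField IsDedekindDomain Matrix Set
open scoped MatrixGroups ENNReal NNReal Pointwise

namespace Literature.NumberTheory.Automorphic

section Conj

variable {n : ℕ} {K : Type} [Field K] [NumberField K] {a b : ℕ}
variable [MeasurableSpace (GL (Fin n) (AdeleRing (𝓞 K) K))] [BorelSpace (GL (Fin n) (AdeleRing (𝓞 K) K))]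

/-- **Conjugation preserving the lattice preserves Haar measure.** If `g ∈ GL_n(𝔸_K)` normalises
`U_{[a,b]}(𝔸_K)` and conjugation by `g` maps `U_{[a,b]}(K)` onto itself, then `u ↦ g u g⁻¹` preserves
every Haar measure `ν` of `U_{[a,b]}(𝔸_K)`: `mulEquivHaarChar = 1` by `HaarCharLattice`, the box being a
fundamental domain of finite positive measure (the non-abelian product formula). [folklore] -/
theorem map_colRangeConj_eq_self (g : GL (Fin n) (AdeleRing (𝓞 K) K))
    (hg : ∀ u : GL (Fin n) (AdeleRing (𝓞 K) K), u ∈ adelicColRange n K a b ↔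
      g * u * g⁻¹ ∈ adelicColRange n K a b)
    (hgK : ∀ u : ↥(adelicColRange n K a b), colRangeConj g hg u ∈ rationalColRange n K a b ↔
      u ∈ rationalColRange n K a b)
    (ν : Measure ↥(adelicColRange n K a b)) [IsHaarMeasure ν] :
    ν.map (colRangeConj g hg) = ν :=
  Literature.MeasureTheory.Group.map_continuousMulEquiv_eq_self ν (rationalColRange n K a b)
    (isFundamentalDomain_colRangeTateDomain ν) (measure_colRangeTateDomain_pos_of_isHaarMeasure ν).ne'
    (measure_colRangeTateDomain_lt_top ν).ne (colRangeConj g hg) hgK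

/-- Conjugation by such a `g` is measure preserving. [folklore] -/
theorem measurePreserving_colRangeConj (g : GL (Fin n) (AdeleRing (𝓞 K) K))
    (hg : ∀ u : GL (Fin n) (AdeleRing (𝓞 K) K), u ∈ adelicColRange n K a b ↔
      g * u * g⁻¹ ∈ adelicColRange n K a b)
    (hgK : ∀ u : ↥(adelicColRange n K a b), colRangeConj g hg u ∈ rationalColRange n K a b ↔
      u ∈ rationalColRange n K a b)
    (ν : Measure ↥(adelicColRange n K a b)) [IsHaarMeasure ν] :
    MeasurePreserving (colRangeConj g hg) ν ν :=
  ⟨(colRangeConj g hg).continuous.measurable, map_colRangeConj_eq_self g hg hgK ν⟩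

/-- The change of variables `∫ f(g u g⁻¹) dν(u) = ∫ f dν` for measurable `f ≥ 0`. [folklore] -/
theorem lintegral_colRangeConj_eq (g : GL (Fin n) (AdeleRing (𝓞 K) K))
    (hg : ∀ u : GL (Fin n) (AdeleRing (𝓞 K) K), u ∈ adelicColRange n K a b ↔
      g * u * g⁻¹ ∈ adelicColRange n K a b)
    (hgK : ∀ u : ↥(adelicColRange n K a b), colRangeConj g hg u ∈ rationalColRange n K a b ↔
      u ∈ rationalColRange n K a b)
    (ν : Measure ↥(adelicColRange n K a b)) [IsHaarMeasure ν]
    {f : ↥(adelicColRange n K a b) → ℝ≥0∞} (hf : Measurable f) :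
    ∫⁻ u, f (colRangeConj g hg u) ∂ν = ∫⁻ u, f u ∂ν :=
  (measurePreserving_colRangeConj g hg hgK ν).lintegral_comp hf

/-- The change of variables `∫ f(g u g⁻¹) dν(u) = ∫ f dν` for the Bochner integral (no measurability
needed). [folklore] -/
theorem integral_colRangeConj_eq (g : GL (Fin n) (AdeleRing (𝓞 K) K))
    (hg : ∀ u : GL (Fin n) (AdeleRing (𝓞 K) K), u ∈ adelicColRange n K a b ↔
      g * u * g⁻¹ ∈ adelicColRange n K a b)
    (hgK : ∀ u : ↥(adelicColRange n K a b), colRangeConj g hg u ∈ rationalColRange n K a b ↔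
      u ∈ rationalColRange n K a b)
    (ν : Measure ↥(adelicColRange n K a b)) [IsHaarMeasure ν]
    {E : Type*} [NormedAddCommGroup E] [NormedSpace ℝ E] (f : ↥(adelicColRange n K a b) → E) :
    ∫ u, f (colRangeConj g hg u) ∂ν = ∫ u, f u ∂ν :=
  (measurePreserving_colRangeConj g hg hgK ν).integral_comp'
    (f := (colRangeConj g hg).toHomeomorph.toMeasurableEquiv) f

/-- The change of variables on a set: `∫_{S} f(g u g⁻¹) dν(u) = ∫_{g S g⁻¹} f dν`. [folklore] -/
theorem setIntegral_colRangeConj_eq (g : GL (Fin n) (AdeleRing (𝓞 K) K))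
    (hg : ∀ u : GL (Fin n) (AdeleRing (𝓞 K) K), u ∈ adelicColRange n K a b ↔
      g * u * g⁻¹ ∈ adelicColRange n K a b)
    (hgK : ∀ u : ↥(adelicColRange n K a b), colRangeConj g hg u ∈ rationalColRange n K a b ↔
      u ∈ rationalColRange n K a b)
    (ν : Measure ↥(adelicColRange n K a b)) [IsHaarMeasure ν]
    {E : Type*} [NormedAddCommGroup E] [NormedSpace ℝ E] (f : ↥(adelicColRange n K a b) → E)
    (S : Set ↥(adelicColRange n K a b)) :
    ∫ u in S, f (colRangeConj g hg u) ∂ν = ∫ u in colRangeConj g hg '' S, f u ∂ν := by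
  have h := (measurePreserving_colRangeConj g hg hgK ν).setIntegral_image_emb
    (colRangeConj g hg).toHomeomorph.toMeasurableEquiv.measurableEmbedding f S
  exact h.symm

/-- For a **rational** normaliser the lattice condition is automatic
(`colRangeConj_mem_rationalColRange_iff`): `ℝ≥0∞` form. [folklore] -/
theorem lintegral_colRangeConj_eq_of_rational {g₀ : GL (Fin n) K}
    (hg : ∀ u : GL (Fin n) (AdeleRing (𝓞 K) K), u ∈ adelicColRange n K a b ↔
      Matrix.GeneralLinearGroup.map (algebraMap K (AdeleRing (𝓞 K) K)) g₀ * u *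
        (Matrix.GeneralLinearGroup.map (algebraMap K (AdeleRing (𝓞 K) K)) g₀)⁻¹ ∈ adelicColRange n K a b)
    (ν : Measure ↥(adelicColRange n K a b)) [IsHaarMeasure ν]
    {f : ↥(adelicColRange n K a b) → ℝ≥0∞} (hf : Measurable f) :
    ∫⁻ u, f (colRangeConj _ hg u) ∂ν = ∫⁻ u, f u ∂ν :=
  lintegral_colRangeConj_eq _ hg (colRangeConj_mem_rationalColRange_iff hg) ν hf

/-- For a **rational** normaliser: Bochner form. [folklore] -/
theorem integral_colRangeConj_eq_of_rational {g₀ : GL (Fin n) K}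
    (hg : ∀ u : GL (Fin n) (AdeleRing (𝓞 K) K), u ∈ adelicColRange n K a b ↔
      Matrix.GeneralLinearGroup.map (algebraMap K (AdeleRing (𝓞 K) K)) g₀ * u *
        (Matrix.GeneralLinearGroup.map (algebraMap K (AdeleRing (𝓞 K) K)) g₀)⁻¹ ∈ adelicColRange n K a b)
    (ν : Measure ↥(adelicColRange n K a b)) [IsHaarMeasure ν]
    {E : Type*} [NormedAddCommGroup E] [NormedSpace ℝ E] (f : ↥(adelicColRange n K a b) → E) :
    ∫ u, f (colRangeConj _ hg u) ∂ν = ∫ u, f u ∂ν :=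
  integral_colRangeConj_eq _ hg (colRangeConj_mem_rationalColRange_iff hg) ν f

/-- For a **rational** normaliser: measure preservation. [folklore] -/
theorem measurePreserving_colRangeConj_of_rational {g₀ : GL (Fin n) K}
    (hg : ∀ u : GL (Fin n) (AdeleRing (𝓞 K) K), u ∈ adelicColRange n K a b ↔
      Matrix.GeneralLinearGroup.map (algebraMap K (AdeleRing (𝓞 K) K)) g₀ * u *
        (Matrix.GeneralLinearGroup.map (algebraMap K (AdeleRing (𝓞 K) K)) g₀)⁻¹ ∈ adelicColRange n K a b)
    (ν : Measure ↥(adelicColRange n K a b)) [IsHaarMeasure ν] :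
    MeasurePreserving (colRangeConj _ hg) ν ν :=
  measurePreserving_colRangeConj _ hg (colRangeConj_mem_rationalColRange_iff hg) ν

/-- **The image of the box under a rational normaliser is again a fundamental domain** of
`U_{[a,b]}(K)` (`HaarCharLattice.isFundamentalDomain_image_continuousMulEquiv`). [folklore] -/
theorem isFundamentalDomain_image_colRangeConj (g : GL (Fin n) (AdeleRing (𝓞 K) K))
    (hg : ∀ u : GL (Fin n) (AdeleRing (𝓞 K) K), u ∈ adelicColRange n K a b ↔
      g * u * g⁻¹ ∈ adelicColRange n K a b)
    (hgK : ∀ u : ↥(adelicColRange n K a b), colRangeConj g hg u ∈ rationalColRange n K a b ↔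
      u ∈ rationalColRange n K a b)
    (ν : Measure ↥(adelicColRange n K a b)) [IsHaarMeasure ν] :
    IsFundamentalDomain ↥(rationalColRange n K a b) (colRangeConj g hg '' colRangeTateDomain n K a b) ν :=
  Literature.MeasureTheory.Group.isFundamentalDomain_image_continuousMulEquiv ν (rationalColRange n K a b)
    (isFundamentalDomain_colRangeTateDomain ν) (colRangeConj g hg) hgK

end Conj

end Literature.NumberTheory.Automorphic
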